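import Mathlib
import Literature.NumberTheory.EllipticCurves.ThreeIsogeny

/-!
# Rank-2 observatory — KERNEL-3ISO (A2): Kummer injectivity for the `3`-isogeny descent maps (Cohen, Lemma 8.4.5)

HONEST FRAMING: per-curve certified theorems and census instruments; no claim on BSD in rank ≥ 2.

Field algebra behind `ker α̂ ⊆ φ(E(F))` and `ker α ⊆ φ̂(Ê(F))` for the Vélu pair
`E = E_{m,s} : y² = x³ + (mx + s)²`, `Ê = [0, m², 0, -18ms, -(27s² + 16m³s)]` (tree
`IsVeluThreePair m s W W'`, `W = threeTorsionModel m s`, `W' = threeIsogenyCodomain m s`), following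
Cohen, *Number Theory I* (GTM 239), Prop. 8.4.4 (2) and Lemma 8.4.5 with `(a, b, d) = (m, s, 1)`. Cohen's
coordinate on `Ê` is `x̂ = X + 4m²/3` (`X` = Vélu's), in which `Ê : ŷ² = x̂³ - 3(m x̂ + ŝ)²`,
`ŝ = (27 s - 4 m³)/9`.

* `ThreeIsoKummer.preimage_of_codomain` (**`ker α̂ ⊆ Im φ`**): if `Q = (X, Y) ∈ Ê(F)` and
  `r, t ∈ F` satisfy `(r + tθ)³ = Y - (m x̂ + ŝ)θ` coefficientwise (`θ² = -3`), i.e.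
  `r³ - 9rt² = Y`, `27r²t - 27t³ + 9mX + 8m³ + 27s = 0`, together with the norm relation
  `3r² + 9t² = 3X + 4m²` (`= 3x̂`; over an ordered field it follows from the other two,
  `norm_rel_of_cube`), then `x = r² - (t - 2m/3)²`, `y = r x` is a point of `E(F)` with `x ≠ 0` and
  Vélu's `φ(x, y) = (X, Y)` (Cohen: `u = r`, `v = t`, `x = -b/(v + a/3) = u² - d(v - 2a/3)²`).
* `ThreeIsoKummer.preimage_of_domain` (**`ker α ⊆ Im φ̂`**): if `P = (x, y) ∈ E(F)` and
  `y - (mx + s) = g³` with `g ≠ 0`, then with `u = 3(g² + x)/(2g)`, `v = (g² - x)/(2g)`,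
  `x̂ = u² + 3(v - 2m/3)²`, `X = x̂ - 4m²/3`, `Y = u x̂`: `(X, Y) ∈ Ê(F)`, `3X + 4m² ≠ 0` (when `-3` is
  not a square in `F`), and Cohen's dual isogeny `φ̂ = (U/h², S·y/h³)`,
  `U = X³ - 36msX - 108s² - 16m³s`, `h = 3X + 4m²`, `S = X³ + 4m²X² + 36msX + 216s² - 16m³s`
  (Prop. 8.4.3 written in Vélu's coordinate, cleared of denominators), maps `(X, Y)` to `(x, y)`.
Proof method: the hypotheses determine `s`, `X`, `Y` (resp. `s`, `y`) as rational functions of the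
remaining variables; after substitution every claim is a polynomial identity (`ring`).

## References
* H. Cohen, *Number Theory I*, GTM 239, §8.4: Prop. 8.4.3, Prop. 8.4.4, Lemma 8.4.5, Cor. 8.4.6.
  [cite: Cohen2007NumberTheoryI, §8.4 (Prop. 8.4.3–8.4.4, Lemma 8.4.5, Cor. 8.4.6)]
* H. Cohen, F. Pazuki, Acta Arith. 140 (2009), Prop. 2.2, Thm. 3.1, Thm. 4.1. [cite: CohenPazuki2009, §2–4]
-/

set_option linter.dupNamespace false

namespace Summit.BirchSwinnertonDyer.BirchSwinnertonDyer.Rank2Observatory.ThreeIsoKummer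

open Literature.NumberTheory.EllipticCurves WeierstrassCurve

section Algebra

variable {F : Type*} [Field F]

/-! ### `ker α̂ ⊆ Im φ` (Cohen, Prop. 8.4.4 (2) "if", Lemma 8.4.5 with `δ̂ = θ`) -/

/-- The norm identity `N(r + tθ)³ = N((r + tθ)³)` for `θ² = -3`, written out. [folklore] -/
theorem norm_cube_identity (r t : F) :
    (r ^ 2 + 3 * t ^ 2) ^ 3 = (r ^ 3 - 9 * r * t ^ 2) ^ 2 + 3 * (3 * r ^ 2 * t - 3 * t ^ 3) ^ 2 := by
  ring

/-- Over a linearly ordered field the norm relation `3r² + 9t² = 3X + 4m²` (i.e. `r² + 3t² = x̂`)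
follows from `(r + tθ)³ = Y - (m x̂ + ŝ)θ` and the equation of `Ê` (cube roots are unique):
Cohen, Lemma 8.4.5 (1) (`γ σ(γ) = x̂`). [cite: Cohen2007NumberTheoryI, Lemma 8.4.5 (1)] -/
theorem norm_rel_of_cube {K : Type*} [Field K] [LinearOrder K] [IsStrictOrderedRing K]
    {m s X Y r t : K}
    (hQ : Y ^ 2 = X ^ 3 + m ^ 2 * X ^ 2 - 18 * m * s * X - (27 * s ^ 2 + 16 * m ^ 3 * s))
    (h1 : r ^ 3 - 9 * r * t ^ 2 = Y)
    (h2 : 27 * r ^ 2 * t - 27 * t ^ 3 + 9 * m * X + 8 * m ^ 3 + 27 * s = 0) :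
    3 * r ^ 2 + 9 * t ^ 2 = 3 * X + 4 * m ^ 2 := by
  have e1 : (3 * r ^ 2 + 9 * t ^ 2) ^ 3 =
      27 * ((r ^ 3 - 9 * r * t ^ 2) ^ 2 + 3 * (3 * r ^ 2 * t - 3 * t ^ 3) ^ 2) := by ring
  have e2 : 3 * r ^ 2 * t - 3 * t ^ 3 = -(9 * m * X + 8 * m ^ 3 + 27 * s) / 9 :=
    (eq_div_iff (by norm_num : (9 : K) ≠ 0)).mpr (by linear_combination h2)
  have e3 : (3 * X + 4 * m ^ 2) ^ 3 =
      27 * ((r ^ 3 - 9 * r * t ^ 2) ^ 2 + 3 * (3 * r ^ 2 * t - 3 * t ^ 3) ^ 2) := by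
    rw [e2, h1]; linear_combination (-27 : K) * hQ
  have hcube : (3 * r ^ 2 + 9 * t ^ 2) ^ 3 = (3 * X + 4 * m ^ 2) ^ 3 := by rw [e1, e3]
  have hodd : Odd 3 := by decide
  exact (hodd.strictMono_pow (R := K)).injective hcube

/-- **`ker α̂ ⊆ Im φ`, the algebra** (Cohen, Prop. 8.4.4 (2) and Lemma 8.4.5 for `(a, b, d) = (m, s, 1)`,
in Vélu's coordinate `X = x̂ - 4m²/3` on `Ê`). From `r³ - 9rt² = Y`,
`27r²t - 27t³ + 9mX + 8m³ + 27s = 0` (together: `(r + tθ)³ = Y - (m x̂ + ŝ)θ`) and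
`3r² + 9t² = 3X + 4m²`, the point `x = r² - (t - 2m/3)²`, `y = r x` lies on `E : y² = x³ + (mx + s)²`,
has `x ≠ 0` (as `s ≠ 0`), and `φ(x, y) = ((x³ + 4msx + 4s²)/x², y(x³ - 4msx - 8s²)/x³) = (X, Y)`.
[cite: Cohen2007NumberTheoryI, Prop. 8.4.4 (2), Lemma 8.4.5] -/
theorem preimage_of_codomain {m s X Y r t : F} (h3 : (3 : F) ≠ 0) (hs : s ≠ 0)
    (h1 : r ^ 3 - 9 * r * t ^ 2 = Y)
    (h2 : 27 * r ^ 2 * t - 27 * t ^ 3 + 9 * m * X + 8 * m ^ 3 + 27 * s = 0)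
    (hn : 3 * r ^ 2 + 9 * t ^ 2 = 3 * X + 4 * m ^ 2) :
    let x := r ^ 2 - (t - 2 * m / 3) ^ 2
    let y := r * x
    x ≠ 0 ∧ y ^ 2 = x ^ 3 + m ^ 2 * x ^ 2 + 2 * m * s * x + s ^ 2 ∧
      (x ^ 3 + 4 * m * s * x + 4 * s ^ 2) / x ^ 2 = X ∧
      y * (x ^ 3 - 4 * m * s * x - 8 * s ^ 2) / x ^ 3 = Y := by
  intro x y
  have h9 : (9 : F) ≠ 0 := by
    have : (9 : F) = 3 * 3 := by norm_num
    rw [this]; exact mul_ne_zero h3 h3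
  have h27 : (27 : F) ≠ 0 := by
    have : (27 : F) = 3 * 9 := by norm_num
    rw [this]; exact mul_ne_zero h3 h9
  -- the hypotheses determine `X`, then `s`, then `Y`, as functions of `r, t, m`
  have hX : X = (3 * r ^ 2 + 9 * t ^ 2 - 4 * m ^ 2) / 3 :=
    (eq_div_iff h3).mpr (by linear_combination -hn)
  subst hX
  have hs' : s = -(27 * r ^ 2 * t - 27 * t ^ 3 + 9 * m * ((3 * r ^ 2 + 9 * t ^ 2 - 4 * m ^ 2) / 3) +
      8 * m ^ 3) / 27 :=
    (eq_div_iff h27).mpr (by linear_combination h2)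
  subst hs'
  subst h1
  -- `s = -(t + m/3)·x`, so `x ≠ 0`
  have hsx : -(27 * r ^ 2 * t - 27 * t ^ 3 + 9 * m * ((3 * r ^ 2 + 9 * t ^ 2 - 4 * m ^ 2) / 3) +
      8 * m ^ 3) / 27 = -(t + m / 3) * x := by
    simp only [x]; field_simp; ring
  have hx : x ≠ 0 := by
    intro hx0
    apply hs
    rw [hsx, hx0, mul_zero]
  refine ⟨hx, ?_, ?_, ?_⟩
  · simp only [y, x]; field_simp; ring
  · rw [div_eq_iff (pow_ne_zero 2 hx)]; simp only [x]; field_simp; ring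
  · rw [div_eq_iff (pow_ne_zero 3 hx)]; simp only [y, x]; field_simp; ring

/-! ### `ker α ⊆ Im φ̂` (Cohen, Cor. 8.4.6 (2) "if": Lemma 8.4.5 for the pair `(Ê, E)`, `δ = 3 ∈ F`) -/

/-- **`ker α ⊆ Im φ̂`, the algebra** (Cohen, Cor. 8.4.6 (2) via Lemma 8.4.5 applied to `(Ê, E ≅ Ê̂)`, where
`√(d̂̂) = 3` is rational). Let `P = (x, y) ∈ E : y² = x³ + (mx + s)²` with `y - (mx + s) = g³`, `g ≠ 0`. Put
`u = 3(g² + x)/(2g)`, `v = (g² - x)/(2g)`, `x̂ = u² + 3(v - 2m/3)²`, `X = x̂ - 4m²/3`, `Y = u x̂`. Then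
`(X, Y) ∈ Ê : Y² = X³ + m²X² - 18msX - (27s² + 16m³s)` and, provided `x̂ ≠ 0`, Cohen's dual isogeny in
Vélu's coordinate, `φ̂(X, Y) = (U/h², S Y/h³)` with `h = 3X + 4m² = 3x̂`, `U = X³ - 36msX - 108s² - 16m³s`,
`S = X³ + 4m²X² + 36msX + 216s² - 16m³s` (Prop. 8.4.3), maps `(X, Y)` to `(x, y)`.
[cite: Cohen2007NumberTheoryI, Prop. 8.4.3, Lemma 8.4.5, Cor. 8.4.6 (2)] -/
theorem preimage_of_domain {m s x y g : F} (h2 : (2 : F) ≠ 0) (h3 : (3 : F) ≠ 0) (hg : g ≠ 0)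
    (hP : y ^ 2 = x ^ 3 + m ^ 2 * x ^ 2 + 2 * m * s * x + s ^ 2) (hcube : y - (m * x + s) = g ^ 3) :
    let u := 3 * (g ^ 2 + x) / (2 * g)
    let v := (g ^ 2 - x) / (2 * g)
    let xh := u ^ 2 + 3 * (v - 2 * m / 3) ^ 2
    let X := xh - 4 * m ^ 2 / 3
    let Y := u * xh
    Y ^ 2 = X ^ 3 + m ^ 2 * X ^ 2 - 18 * m * s * X - (27 * s ^ 2 + 16 * m ^ 3 * s) ∧
      3 * X + 4 * m ^ 2 = 3 * xh ∧
      (xh ≠ 0 →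
        (X ^ 3 - 36 * m * s * X - (108 * s ^ 2 + 16 * m ^ 3 * s)) / (3 * X + 4 * m ^ 2) ^ 2 = x ∧
        (X ^ 3 + 4 * m ^ 2 * X ^ 2 + 36 * m * s * X + (216 * s ^ 2 - 16 * m ^ 3 * s)) * Y /
            (3 * X + 4 * m ^ 2) ^ 3 = y) := by
  intro u v xh X Y
  have hg3 : 2 * g ^ 3 ≠ 0 := mul_ne_zero h2 (pow_ne_zero 3 hg)
  have hg2 : 2 * g ≠ 0 := mul_ne_zero h2 hg
  -- `y`, then `s`, as functions of `x, g, m`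
  have hy : y = g ^ 3 + m * x + s := by linear_combination hcube
  subst hy
  have hs : s = (x ^ 3 - g ^ 6 - 2 * g ^ 3 * m * x) / (2 * g ^ 3) :=
    (eq_div_iff hg3).mpr (by linear_combination hP)
  subst hs
  have hh : 3 * X + 4 * m ^ 2 = 3 * xh := by simp only [X]; field_simp; ring
  refine ⟨?_, hh, fun hxh => ⟨?_, ?_⟩⟩
  · simp only [Y, X, xh, u, v]; field_simp; ring
  · have hden : (3 * X + 4 * m ^ 2) ^ 2 ≠ 0 := by rw [hh]; exact pow_ne_zero 2 (mul_ne_zero h3 hxh)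
    rw [div_eq_iff hden, hh]; simp only [X, xh, u, v]; field_simp; ring
  · have hden : (3 * X + 4 * m ^ 2) ^ 3 ≠ 0 := by rw [hh]; exact pow_ne_zero 3 (mul_ne_zero h3 hxh)
    rw [div_eq_iff hden, hh]; simp only [Y, X, xh, u, v]; field_simp; ring

/-- Over a field in which `-3` is not a square, `u² + 3w² = 0` forces `u = w = 0`. [folklore] -/
theorem eq_zero_of_sq_add_three_mul_sq {u w : F} (hF : ∀ z : F, z ^ 2 ≠ -3) (h : u ^ 2 + 3 * w ^ 2 = 0) :
    u = 0 ∧ w = 0 := by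
  by_cases hw : w = 0
  · subst hw
    have hu2 : u ^ 2 = 0 := by linear_combination h
    exact ⟨pow_eq_zero_iff two_ne_zero |>.mp hu2, rfl⟩
  · exfalso
    apply hF (u / w)
    rw [div_pow, div_eq_iff (pow_ne_zero 2 hw)]
    linear_combination h

/-- In `preimage_of_domain`, `x̂ = u² + 3(v - 2m/3)² ≠ 0` as soon as `-3` is not a square in `F` and
`4 m³ ≠ 27 s` (non-zero discriminant): `x̂ = 0` would force `g = 2m/3`, `x = -4m²/9`, `27s = 4m³`.
[cite: Cohen2007NumberTheoryI, §8.4 (proof of Prop. 8.4.4)] -/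
theorem xh_ne_zero {m s x y g : F} (h2 : (2 : F) ≠ 0) (h3 : (3 : F) ≠ 0) (hF : ∀ z : F, z ^ 2 ≠ -3)
    (hg : g ≠ 0) (hdisc : 4 * m ^ 3 - 27 * s ≠ 0)
    (hP : y ^ 2 = x ^ 3 + m ^ 2 * x ^ 2 + 2 * m * s * x + s ^ 2) (hcube : y - (m * x + s) = g ^ 3) :
    (3 * (g ^ 2 + x) / (2 * g)) ^ 2 + 3 * ((g ^ 2 - x) / (2 * g) - 2 * m / 3) ^ 2 ≠ 0 := by
  intro h0
  obtain ⟨hu, hv⟩ := eq_zero_of_sq_add_three_mul_sq hF h0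
  have hg2 : 2 * g ≠ 0 := mul_ne_zero h2 hg
  -- `u = 0`: `x = -g²`
  have hx : x = -g ^ 2 := by
    rcases div_eq_zero_iff.mp hu with h | h
    · have hx3 : 3 * (g ^ 2 + x) = 0 := h
      have := (mul_eq_zero.mp hx3).resolve_left h3
      linear_combination this
    · exact absurd h hg2
  -- `v = 2m/3`: `3g = 2m`
  have hgm : 3 * g - 2 * m = 0 := by
    have hv' : (g ^ 2 - x) / (2 * g) = 2 * m / 3 := by linear_combination hv
    rw [div_eq_div_iff hg2 h3, hx] at hv'
    have : 2 * g * (3 * g - 2 * m) = 0 := by linear_combination hv'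
    exact (mul_eq_zero.mp this).resolve_left hg2
  -- the curve equation: `g⁶ + 2g³(mx + s) = x³`, i.e. (with `x = -g²`) `g³ - m g² + s = 0`
  have hy : y = g ^ 3 + m * x + s := by linear_combination hcube
  have hE : g ^ 6 + 2 * g ^ 3 * (m * x + s) - x ^ 3 = 0 := by
    rw [hy] at hP; linear_combination hP
  have hF0 : g ^ 3 - m * g ^ 2 + s = 0 := by
    rw [hx] at hE
    have : 2 * g ^ 3 * (g ^ 3 - m * g ^ 2 + s) = 0 := by linear_combination hE
    exact (mul_eq_zero.mp this).resolve_left (mul_ne_zero h2 (pow_ne_zero 3 hg))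
  apply hdisc
  linear_combination (-27 : F) * hF0 + (9 * g ^ 2 - 3 * m * g - 2 * m ^ 2) * hgm

end Algebra

/-! ### On points of the Vélu pair `(W, W')` -/

section Points

variable {F : Type*} [Field F] [DecidableEq F] {m s : F} {W W' : WeierstrassCurve F}

/-- **`ker α̂ ⊆ φ(E(F))` on points.** If `Q = (X, Y) ∈ Ê(F)` and `(r + tθ)³ = Y - (m x̂ + ŝ)θ`
coefficientwise with the norm relation `3r² + 9t² = 3X + 4m²`, then `Q = φ(P)` for the explicit point
`P = (r² - (t - 2m/3)², r·(r² - (t - 2m/3)²)) ∈ E(F)` (`φ` = the tree's Vélu three-isogeny `pointFun`).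
[cite: Cohen2007NumberTheoryI, Prop. 8.4.4 (2), Lemma 8.4.5] -/
theorem exists_pointFun_eq_of_cube (h : IsVeluThreePair m s W W') (h3 : (3 : F) ≠ 0) {X Y r t : F}
    (hQ : W'.toAffine.Nonsingular X Y) (h1 : r ^ 3 - 9 * r * t ^ 2 = Y)
    (h2 : 27 * r ^ 2 * t - 27 * t ^ 3 + 9 * m * X + 8 * m ^ 3 + 27 * s = 0)
    (hn : 3 * r ^ 2 + 9 * t ^ 2 = 3 * X + 4 * m ^ 2) :
    ∃ P : W.toAffine.Point, h.pointFun P = .some X Y hQ := by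
  obtain ⟨hx, hE, hX, hY⟩ := preimage_of_codomain h3 h.s_ne h1 h2 hn
  have hP : W.toAffine.Nonsingular (r ^ 2 - (t - 2 * m / 3) ^ 2) (r * (r ^ 2 - (t - 2 * m / 3) ^ 2)) :=
    (Affine.equation_iff_nonsingular_of_Δ_ne_zero (W := W.toAffine) h.Δ_ne).mp
      ((h.equation_iff _ _).mpr hE)
  refine ⟨.some _ _ hP, ?_⟩
  rw [h.pointFun_some hP hx]
  simp only [Affine.Point.some.injEq, IsVeluThreePair.X, IsVeluThreePair.Y]
  exact ⟨hX, hY⟩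

/-- Over an ordered field (e.g. `ℚ`) the norm relation is automatic (`norm_rel_of_cube`):
`(r + tθ)³ = Y - (m x̂ + ŝ)θ` alone gives `Q = (X, Y) ∈ φ(E(F))`. This is the "if" direction of Cohen,
Prop. 8.4.4 (2) (`α̂(Q) = 1 ⇒ Q ∈ Im φ`). [cite: Cohen2007NumberTheoryI, Prop. 8.4.4 (2)] -/
theorem exists_pointFun_eq_of_cube' {K : Type*} [Field K] [LinearOrder K] [IsStrictOrderedRing K]
    [DecidableEq K] {m s : K} {W W' : WeierstrassCurve K} (h : IsVeluThreePair m s W W') {X Y r t : K}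
    (hQ : W'.toAffine.Nonsingular X Y) (h1 : r ^ 3 - 9 * r * t ^ 2 = Y)
    (h2 : 27 * r ^ 2 * t - 27 * t ^ 3 + 9 * m * X + 8 * m ^ 3 + 27 * s = 0) :
    ∃ P : W.toAffine.Point, h.pointFun P = .some X Y hQ :=
  exists_pointFun_eq_of_cube h (by norm_num) hQ h1 h2
    (norm_rel_of_cube ((h.equation'_iff X Y).mp hQ.left) h1 h2)

omit [DecidableEq F] in
/-- **`ker α ⊆ φ̂(Ê(F))` on points, coordinate form.** If `P = (x, y) ∈ E(F)` with
`y - (mx + s) = g³`, `g ≠ 0`, and `-3` is not a square in `F` (`char F ≠ 3`), there is a point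
`(X, Y) ∈ Ê(F)` off the kernel of `φ̂` (`3X + 4m² ≠ 0`) which Cohen's dual-isogeny formula
`(U/h², S·Y/h³)` (`h = 3X + 4m²`, `U = X³ - 36msX - 108s² - 16m³s`,
`S = X³ + 4m²X² + 36msX + 216s² - 16m³s`) maps to `(x, y)`.
[cite: Cohen2007NumberTheoryI, Prop. 8.4.3, Cor. 8.4.6 (2)] -/
theorem exists_dual_preimage_of_cube (h : IsVeluThreePair m s W W') (h3 : (3 : F) ≠ 0)
    (hF : ∀ z : F, z ^ 2 ≠ -3) {x y g : F} (hP : W.toAffine.Nonsingular x y) (hg : g ≠ 0)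
    (hcube : y - (m * x + s) = g ^ 3) :
    ∃ X Y : F, W'.toAffine.Nonsingular X Y ∧ 3 * X + 4 * m ^ 2 ≠ 0 ∧
      (X ^ 3 - 36 * m * s * X - (108 * s ^ 2 + 16 * m ^ 3 * s)) / (3 * X + 4 * m ^ 2) ^ 2 = x ∧
      (X ^ 3 + 4 * m ^ 2 * X ^ 2 + 36 * m * s * X + (216 * s ^ 2 - 16 * m ^ 3 * s)) * Y /
          (3 * X + 4 * m ^ 2) ^ 3 = y := by
  have hE := (h.equation_iff x y).mp hP.left
  obtain ⟨hQ, hh, himg⟩ := preimage_of_domain h.two_ne h3 hg hE hcube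
  have hxh := xh_ne_zero h.two_ne h3 hF hg h.disc_ne hE hcube
  obtain ⟨hX, hY⟩ := himg hxh
  refine ⟨_, _, (Affine.equation_iff_nonsingular_of_Δ_ne_zero (W := W'.toAffine) h.Δ'_ne).mp
    ((h.equation'_iff _ _).mpr hQ), ?_, hX, hY⟩
  rw [hh]; exact mul_ne_zero h3 hxh

end Points

end Summit.BirchSwinnertonDyer.BirchSwinnertonDyer.Rank2Observatory.ThreeIsoKummer
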